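/-
Copyright (c) 2026 the pub-hodgecm-mathlib formalisation cell (harness21).  Prover seat hodgecm-mathlib-K2E5-p16 (g3) (cross-unit hand on E3's BONUS road (d-w) of ‹J3› v2,
road owner K2E3-p03 (g3); deal (D44) of K2E3-plan (g2) 2026-09-04T03:06Z «WILD ANISOTROPIC PLANE INDEX»): the LEVEL of `U(⟨1,−ξ⟩)(L⁺_v)` inside `GL₂(L_w)` at a ramified place.
-/
import Summits.HodgeConjecture.HodgeConjecture.Theorems.K2E3WildAnisotropicPlaneNonIntegral   -- ★ p856923∕p856942 (this seat): `exists_fixed_small_nonnorm_log`, CM dress tools (+ ★ datum toolkit, ★ dictionary, ★ `F0P3cDyRamWildPlaceDatum`)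
import HarnessLib

/-!
# K2 ∕ E3, road (d-w) of ‹J3› v2 — (D44) `K2E3WildAnisotropicPlaneIndex`: THE LEVEL OF THE ANISOTROPIC UNITARY PLANE `U(⟨1,−ξ⟩)` AT A RAMIFIED PLACE IS EXACTLY `d − 1`

Cell `hodgecm-mathlib` (Track B «K2-LIT»), item h413 = `stmt-HodgeConjecture-24833`, route of record `route-HodgeConjecture-HCCMUnconditional`; PROOF lane (theorems only:
no `def`, no `instance`, no `notation`, no named fact, no `sorry`), `--supports stmt-HodgeConjecture-24833 --as helper`; count-neutral.  ROAD (d-w) (dyadic ramified leaf (J3d-w)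
of ‹J3› v2, owner K2E3-p03 (g3)): the residual letter (W3) «WILD PLANE MASS IDENTITY» compares `t^ω_{⟨1,−ξ⟩,v}(1)(univ)` with `ρ_{Φ₂,v}(1)`; through the ★ radius engine and the
★ wild Lie Gram numbers (K2E4-p09 (g3), p856931∕p856955) it is the residual-count ratio `[U_an : K_an(2ϖ_v)] ∕ [K₂ : K₂(2ϖ_v)]`, and `[U_an : K_an(2ϖ_v)] = [U_an : K_an]·[K_an : K_an(2ϖ_v)]`
with `K_an = U_an ∩ GL₂(𝒪_w)` — the first factor is `1` at a TAME place (★ `anisoPlaneUnit_integralLevel_top_and_compactSpace`) and `> 1` at a WILD one (★ (W3-aux)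
`cmLocalIntegralLevel_anisoPlane_ne_top_of_wild`, p856942).  THIS FILE LOCATES `U_an` INSIDE `GL₂(L_w)` EXACTLY: it lives at LEVEL `d − 1` (`d` = the different exponent of
`L_w ∕ L⁺_v`), and that level is attained.  In the Rogawski dictionary (★ `mem_unitaryGroupOfForm_and_det_eq_one_iff`: `SU(⟨1,−ξ⟩)(F) = {q(a,b) : N a − ξ N b = 1}`, `N z = z·σz`),
with `D = (E∕F, ξ)` the quaternion DIVISION algebra and `Λ = 𝒪_E ⊕ 𝒪_E·j ⊆ 𝒪_D` its «unitary» order: `K_an = Λ¹`, `U_an = 𝒪_D¹ ⊆ (ϖ_E^{−(d−1)}Λ)¹` and `⊄ (ϖ_E^{−(d−2)}Λ)¹`; tame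
(`d = 1`): `Λ = 𝒪_D`.  The closed-form index `[𝒪_D¹ : Λ¹]` by type (`|α|_w ∈ {1, |ϖ_w|}`) is (W3)'s own arithmetic and is NOT computed here.

THE MATHEMATICS (★ datum currency `IsRamifiedQuadraticDatum σ ϖ d t` on ONE complete field `K = E` with involution `σ`; `ξ` a `σ`-fixed unit which is NOT a norm).
* §1 BOUNDED DENOMINATORS (any ramified datum, tame or wild): `N α − ξ N β = 1 ⇒ |α|, |β| ≤ |ϖ|^{−(d−1)}`.  If `|β| > 1` then `|Nα| = |Nβ| =: R > 1` and `x := Nα ∕ (ξ Nβ)` is a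
  fixed unit with `|x − 1| = R⁻¹` which is NOT a norm (else `ξ = N(α∕(zβ))`); the ★ deep-norm theorem (`exists_mul_map_eq_of_fixed_of_v_sub_one_le_pred`: fixed units
  `≡ 1 (mod ϖ^{2d−1})` are norms, Serre's `ψ`) forces `R⁻¹ > |ϖ|^{2d−1}`, i.e. `|β|² = R ≤ |ϖ|^{−(2d−2)}`.  Hence EVERY `g ∈ U(⟨1,−ξ⟩)(F)` has all four entries of valuation
  `≤ |ϖ|^{−(d−1)}` (columns: `N g₀₀ − ξ N g₁₀ = 1`, `N g₁₁ − ξ⁻¹ N g₀₁ = 1`, and `ξ⁻¹` is again a fixed non-norm unit).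
* §2 SHARPNESS (wild, `|2| < 1`): `∃ α β, Nα − ξNβ = 1 ∧ |β| = |ϖ|^{−(d−1)}` EXACTLY — ★ (W3-aux)'s small non-norm logarithm `y` has `|y| ≤ |ϖ|^{2(d−1)}`, so `|β|² = |y|⁻¹ ≥
  |ϖ|^{−(2d−2)}`, and §1 gives `≤`.
* §3 CM DRESS at a ramified place `w ∣ v` of `L ∕ L⁺` with the (L)-kit binder `hd : ∀ τ, |τ|_w = exp(−1) → |σ_wτ − τ|_w = exp(−d)` (= ★ `exists_different_of_ramified` clause 2, the
  currency of ★ `UnitaryFinTopFormLieGramWild*`): entries of every `g ∈ U(σ_w, ⟨1,−ξ_w⟩)(L_w)` are `≤ exp(d−1)`, and at a WILD place (`2 ∈ v`) some `g ∈ SU` has `|g₁₀|_w = exp(d−1)`.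

HONEST LABEL: HC_CM is proved only modulo the 7 printed citations (2 remaining named inputs: hLiu418 = stmt-HodgeConjecture-24832, h413 = stmt-HodgeConjecture-24833) until rung 0
closes; (J3d-w) and (W3) are NOT proved here (the index `[U_an : K_an]` itself is not computed); count-neutral structural input for the (W3) typists.

## References
* [Serre1979] J.-P. Serre, *Local Fields*, GTM 67 (1979) — Ch. V §3 Prop. 5, Cor. 2–3 (`N(U_E^{ψ(n)}) = U_F^{(n)}`, the conductor of a ramified quadratic extension), Ch. XV §2.
* [VignerasLNM800] M.-F. Vignéras, *Arithmétique des algèbres de quaternions*, LNM 800 (1980) — Ch. II §1 (the maximal order `{nrd ∈ 𝒪_F}` of a local division quaternion algebra).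
* [Rogawski1990] J. D. Rogawski, *Automorphic Representations of Unitary Groups in Three Variables*, Ann. of Math. Stud. 123 (1990) — §3.8 p. 33 (`SU(⟨1,−ξ⟩) ≅ D¹`).
* [Jacobowitz1962] R. Jacobowitz, *Hermitian forms over local fields*, Amer. J. Math. 84 (1962) — §§9–11 (ramified dyadic hermitian planes).
* [Kottwitz1988] R. Kottwitz, *Tamagawa numbers*, Ann. of Math. 127 (1988) — §1 Thm. 1.
-/

set_option autoImplicit false
set_option linter.dupNamespace false

noncomputable section

namespace Summit.HodgeConjecture.HodgeConjecture.Cruxes.H413.K2E3WildAnisotropicPlaneIndex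

open WithZero NumberField IsDedekindDomain
open scoped Valued Matrix
open Literature.NumberTheory.Automorphic Literature.NumberTheory.Automorphic.UnitaryGroup
open Literature.NumberTheory.Automorphic.UnitaryThreeFourFrame (IsRamifiedQuadraticDatum)
open Literature.NumberTheory.LocalFields.WildQuadraticDatum
open Summit.HodgeConjecture.HodgeConjecture.Cruxes.H413.K2E3WildAnisotropicPlaneNonIntegral
open Summit.HodgeConjecture.HodgeConjecture.Cruxes.H413.F0P3cDyRamWildPlaceDatum (exists_isRamifiedQuadraticDatum_of_placesOver)

/-! ## §0 `ℤᵐ⁰` bookkeeping: squares against odd and even exponents -/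

/-- In `ℤᵐ⁰`: `γ ≠ 0`, `γ² < exp(2n+1)` ⇒ `γ ≤ exp n` (values are `exp k`, and `2k < 2n + 1 ⇒ k ≤ n`). [cite: Serre1979, Ch. II §1] -/
theorem le_exp_of_mul_self_lt_exp {γ : ℤᵐ⁰} (hγ : γ ≠ 0) {n : ℤ} (h : γ * γ < exp (2 * n + 1)) : γ ≤ exp n := by
  obtain ⟨k, hk⟩ : ∃ k : ℤ, γ = exp k := ⟨_, (exp_log hγ).symm⟩
  rw [hk, ← exp_add, exp_lt_exp] at h
  rw [hk, exp_le_exp]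
  omega

/-- In `ℤᵐ⁰`: `γ ≠ 0`, `exp(2n) ≤ γ²` ⇒ `exp n ≤ γ`. [cite: Serre1979, Ch. II §1] -/
theorem exp_le_of_exp_le_mul_self {γ : ℤᵐ⁰} (hγ : γ ≠ 0) {n : ℤ} (h : exp (2 * n) ≤ γ * γ) : exp n ≤ γ := by
  obtain ⟨k, hk⟩ : ∃ k : ℤ, γ = exp k := ⟨_, (exp_log hγ).symm⟩
  rw [hk, ← exp_add, exp_le_exp] at h
  rw [hk, exp_le_exp]
  omega

/-! ## §1 Bounded denominators: `Nα − ξNβ = 1 ⇒ |α|, |β| ≤ |ϖ|^{−(d−1)}` at every ramified datum -/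

section Datum

variable {K : Type} [Field K] [Valued K ℤᵐ⁰] {σ : K →+* K} {ϖ : K} {d t : ℕ}

omit [Valued K ℤᵐ⁰] in
/-- The inverse of a non-norm is a non-norm. [cite: Serre1979, Ch. V §3 Cor. 3] -/
theorem not_isNorm_inv {ξ : K} (hξN : ¬ ∃ z : K, z * σ z = ξ) : ¬ ∃ z : K, z * σ z = ξ⁻¹ := fun h =>
  hξN (by simpa only [inv_inv] using isNorm_inv h)

/-- **BOUNDED DENOMINATORS.**  At a ramified quadratic datum over a complete field (tame or wild), for a `σ`-fixed unit `ξ` which is NOT a norm: every solution of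
`α·σα − ξ·(β·σβ) = 1` has `|β| ≤ exp(d−1) = |ϖ|^{−(d−1)}` and `|α| ≤ exp(d−1)`.  (If `|β| > 1`: `|Nα| = |Nβ| = R`, `x = Nα∕(ξNβ)` is a fixed non-norm unit with `|x − 1| = R⁻¹`,
and ★ deep norms force `R⁻¹ > |ϖ|^{2d−1}`.)  At a tame place (`d = 1`) this is the integrality `U(⟨1,−ξ⟩) ≤ GL₂(𝒪_E)` of ★ `anisoPlaneUnit_integralLevel_top_and_compactSpace`.
[cite: Serre1979, Ch. V §3 Prop. 5, Cor. 3; Ch. XV §2] [cite: VignerasLNM800, Ch. II §1] -/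
theorem valued_le_exp_of_norm_sub_mul_norm_eq_one [CompleteSpace K] (hD : IsRamifiedQuadraticDatum σ ϖ d t)
    {ξ : K} (hσξ : σ ξ = ξ) (hξ1 : Valued.v ξ = 1) (hξN : ¬ ∃ z : K, z * σ z = ξ)
    {α β : K} (h : α * σ α - ξ * (β * σ β) = 1) :
    Valued.v β ≤ exp ((d - 1 : ℕ) : ℤ) ∧ Valued.v α ≤ exp ((d - 1 : ℕ) : ℤ) := by
  have hD' := hD
  obtain ⟨hσ, hvσ, hϖ, -, -, hd1, -⟩ := hD'
  have hξ0 : ξ ≠ 0 := fun h0 => by rw [h0, map_zero] at hξ1; exact zero_ne_one hξ1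
  have h0le : (1 : ℤᵐ⁰) ≤ exp ((d - 1 : ℕ) : ℤ) := by rw [← exp_zero, exp_le_exp]; positivity
  have hNα : α * σ α = 1 + ξ * (β * σ β) := by linear_combination h
  by_cases hβ1 : Valued.v β ≤ 1
  · -- integral `β`: `|Nα| ≤ 1`
    refine ⟨hβ1.trans h0le, ?_⟩
    rcases eq_or_ne α 0 with rfl | hα0
    · rw [map_zero]; exact zero_le
    · have hα2 : Valued.v α * Valued.v α ≤ 1 := by
        have h1 : Valued.v (α * σ α) ≤ 1 := by
          rw [hNα]
          refine (Valuation.map_add _ _ _).trans (max_le (by rw [map_one]) ?_)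
          rw [map_mul, map_mul, hξ1, one_mul, hvσ]
          exact mul_le_one' hβ1 hβ1
        rwa [map_mul, hvσ] at h1
      have hα1 : Valued.v α ≤ 1 := by
        by_contra hlt
        rw [not_le] at hlt
        exact absurd (lt_of_lt_of_le hlt (le_mul_of_one_le_right' hlt.le)) (not_lt.2 hα2)
      exact hα1.trans h0le
  · -- non-integral `β`
    rw [not_le] at hβ1
    have hβ0 : β ≠ 0 := fun h0 => by rw [h0, map_zero] at hβ1; exact not_lt_zero hβ1
    have hvβ0 : Valued.v β ≠ 0 := (Valuation.ne_zero_iff _).2 hβ0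
    have hR1 : 1 < Valued.v (β * σ β) := by
      rw [map_mul, hvσ]; exact lt_of_lt_of_le hβ1 (le_mul_of_one_le_right' hβ1.le)
    have hNβ0 : β * σ β ≠ 0 := mul_ne_zero hβ0 ((map_ne_zero σ).2 hβ0)
    have hden : ξ * (β * σ β) ≠ 0 := mul_ne_zero hξ0 hNβ0
    have hvden : Valued.v (ξ * (β * σ β)) = Valued.v (β * σ β) := by rw [map_mul, hξ1, one_mul]
    have hvNα : Valued.v (α * σ α) = Valued.v (β * σ β) := by
      rw [hNα, Valuation.map_add_eq_of_lt_right, hvden]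
      rw [map_one, hvden]; exact hR1
    have hNα0 : α * σ α ≠ 0 := fun h0 => by
      rw [h0, map_zero] at hvNα; exact (lt_trans zero_lt_one hR1).ne hvNα
    -- the fixed non-norm unit `x = Nα / (ξ Nβ)` with `|x − 1| = R⁻¹`
    have hσx : σ (α * σ α / (ξ * (β * σ β))) = α * σ α / (ξ * (β * σ β)) := by
      rw [map_div₀, map_mul σ ξ, hσξ, map_mul_map hσ α, map_mul_map hσ β]
    have hx1 : α * σ α / (ξ * (β * σ β)) - 1 = 1 / (ξ * (β * σ β)) := by rw [div_sub_one hden, h]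
    have hvx1 : Valued.v (α * σ α / (ξ * (β * σ β)) - 1) = (Valued.v (β * σ β))⁻¹ := by rw [hx1, map_div₀, map_one, hvden, one_div]
    have hxN : ¬ ∃ z : K, z * σ z = α * σ α / (ξ * (β * σ β)) := by
      rintro ⟨z, hz⟩
      have hz0 : z ≠ 0 := by
        rintro rfl
        rw [zero_mul] at hz
        exact div_ne_zero hNα0 hden hz.symm
      have hxden : z * σ z * (ξ * (β * σ β)) = α * σ α := by rw [hz, div_mul_cancel₀ _ hden]
      refine hξN ⟨α / (z * β), ?_⟩
      rw [map_div₀, map_mul, div_mul_div_comm, ← hxden, div_eq_iff (mul_ne_zero (mul_ne_zero hz0 hβ0) (mul_ne_zero ((map_ne_zero σ).2 hz0) ((map_ne_zero σ).2 hβ0)))]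
      ring
    -- deep norms: `|x − 1| > |ϖ|^{2d−1}`
    have hlt : Valued.v ϖ ^ (2 * d - 1) < Valued.v (α * σ α / (ξ * (β * σ β)) - 1) := by
      by_contra hle
      rw [not_lt] at hle
      exact hxN (exists_mul_map_eq_of_fixed_of_v_sub_one_le_pred hD hσx (n := 2 * d - 1) le_rfl hle)
    -- so `R < exp(2(d−1)+1)`
    have hRlt : Valued.v (β * σ β) < exp (2 * ((d - 1 : ℕ) : ℤ) + 1) := by
      rw [v_varpi_pow hϖ, hvx1] at hlt
      have hR := (lt_inv_comm₀ exp_pos (lt_trans zero_lt_one hR1)).1 hlt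
      rw [← exp_neg, neg_neg] at hR
      refine lt_of_lt_of_le hR (le_of_eq ?_)
      congr 1; omega
    refine ⟨le_exp_of_mul_self_lt_exp hvβ0 (by rw [map_mul, hvσ] at hRlt; exact hRlt), ?_⟩
    have hvα0 : Valued.v α ≠ 0 := (Valuation.ne_zero_iff _).2 (fun h0 => hNα0 (by rw [h0, zero_mul]))
    exact le_exp_of_mul_self_lt_exp hvα0 (by rw [← hvNα, map_mul, hvσ] at hRlt; exact hRlt)

/-- **THE LEVEL OF `U(⟨1,−ξ⟩)`: EVERY UNITARY MATRIX HAS ENTRIES `≤ exp(d−1)`** (no determinant condition): the columns of `g` with `(σg)ᵀ·diag(1,−ξ)·g = diag(1,−ξ)` satisfy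
`N g₀₀ − ξ N g₁₀ = 1` and `N g₁₁ − ξ⁻¹ N g₀₁ = 1`, and `ξ⁻¹` is again a fixed non-norm unit (§1).  `U(⟨1,−ξ⟩)(F) ⊆ ϖ_E^{−(d−1)}·M₂(𝒪_E)`.
[cite: Rogawski1990, §3.8 p. 33] [cite: Serre1979, Ch. V §3 Cor. 3] [cite: VignerasLNM800, Ch. II §1] -/
theorem valued_entry_le_exp_of_unitary_anisoPlane [CompleteSpace K] (hD : IsRamifiedQuadraticDatum σ ϖ d t)
    {ξ : K} (hσξ : σ ξ = ξ) (hξ1 : Valued.v ξ = 1) (hξN : ¬ ∃ z : K, z * σ z = ξ)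
    {g : Matrix (Fin 2) (Fin 2) K} (hg : (g.map σ)ᵀ * !![(1 : K), 0; 0, -ξ] * g = !![(1 : K), 0; 0, -ξ]) (i j : Fin 2) :
    Valued.v (g i j) ≤ exp ((d - 1 : ℕ) : ℤ) := by
  have hσ := hD.1
  have hξ0 : ξ ≠ 0 := fun h0 => by rw [h0, map_zero] at hξ1; exact zero_ne_one hξ1
  -- the two column identities
  have h00 := congrFun (congrFun hg 0) 0
  have h11 := congrFun (congrFun hg 1) 1
  simp only [Matrix.mul_apply, Fin.sum_univ_two, Matrix.transpose_apply, Matrix.map_apply, Matrix.of_apply, Matrix.cons_val', Matrix.cons_val_zero,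
    Matrix.cons_val_one, Matrix.empty_val', Matrix.cons_val_fin_one, Fin.isValue] at h00 h11
  have hcol0 : g 0 0 * σ (g 0 0) - ξ * (g 1 0 * σ (g 1 0)) = 1 := by linear_combination h00
  have hcol1 : g 1 1 * σ (g 1 1) - ξ⁻¹ * (g 0 1 * σ (g 0 1)) = 1 := by
    field_simp
    linear_combination (-1 : K) * h11
  have hσξ' : σ ξ⁻¹ = ξ⁻¹ := by rw [map_inv₀, hσξ]
  have hξ1' : Valued.v ξ⁻¹ = 1 := by rw [map_inv₀, hξ1, inv_one]
  obtain ⟨h10, h00'⟩ := valued_le_exp_of_norm_sub_mul_norm_eq_one hD hσξ hξ1 hξN hcol0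
  obtain ⟨h01, h11'⟩ := valued_le_exp_of_norm_sub_mul_norm_eq_one hD hσξ' hξ1' (not_isNorm_inv hξN) hcol1
  fin_cases i <;> fin_cases j
  · exact h00'
  · exact h01
  · exact h10
  · exact h11'

/-! ## §2 Sharpness at a wild place: the level `d − 1` is attained -/

/-- **SHARPNESS.**  At a WILD ramified datum (`|2| < 1`, complete, finite residue field), for every fixed non-norm unit `ξ` there are `α, β` with `Nα − ξNβ = 1` and
`|β| = exp(d−1) = |ϖ|^{−(d−1)}` EXACTLY: ★ (W3-aux)'s small non-norm logarithm `y` (`|y| ≤ |ϖ|^{2(d−1)}`, `ξy ∈ N`, `(1+y)∕y ∈ N`) gives `Nβ = (ξy)⁻¹` with `|β|² ≥ |ϖ|^{−(2d−2)}`,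
and §1 gives `≤`.  So `U(⟨1,−ξ⟩)(F) ⊄ ϖ_E^{−(d−2)}·M₂(𝒪_E)`: the level of the anisotropic unitary plane is EXACTLY `d − 1 ≥ 1`.
[cite: Serre1979, Ch. V §3 Cor. 3; Ch. XV §2] [cite: Jacobowitz1962, §§9–11] -/
theorem exists_norm_sub_mul_norm_eq_one_valued_eq_exp [CompleteSpace K] [Finite 𝓀[K]] (hD : IsRamifiedQuadraticDatum σ ϖ d t) (h2v : Valued.v (2 : K) < 1)
    {ξ : K} (hσξ : σ ξ = ξ) (hξ1 : Valued.v ξ = 1) (hξN : ¬ ∃ z : K, z * σ z = ξ) :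
    ∃ α β : K, α * σ α - ξ * (β * σ β) = 1 ∧ Valued.v β = exp ((d - 1 : ℕ) : ℤ) := by
  have hvσ := hD.2.1
  have hξ0 : ξ ≠ 0 := fun h => by rw [h, map_zero] at hξ1; exact zero_ne_one hξ1
  obtain ⟨y, -, hy0, hyle, ⟨z₂, hz₂⟩, ⟨z₁, hz₁⟩⟩ := exists_fixed_small_nonnorm_log hD h2v hσξ hξ1 hξN
  have hz₂0 : z₂ ≠ 0 := by
    rintro rfl
    rw [zero_mul] at hz₂
    exact mul_ne_zero hξ0 hy0 hz₂.symm
  have hid : z₁ * σ z₁ - ξ * (z₂⁻¹ * σ z₂⁻¹) = 1 := by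
    rw [map_inv₀, ← mul_inv, hz₂, hz₁]
    field_simp
    ring
  refine ⟨z₁, z₂⁻¹, hid, le_antisymm (valued_le_exp_of_norm_sub_mul_norm_eq_one hD hσξ hξ1 hξN hid).1 ?_⟩
  -- `|z₂⁻¹|² = |ξ y|⁻¹ = |y|⁻¹ ≥ exp(2(d−1))`
  have hvb0 : Valued.v z₂⁻¹ ≠ 0 := (Valuation.ne_zero_iff _).2 (inv_ne_zero hz₂0)
  refine exp_le_of_exp_le_mul_self hvb0 ?_
  have hsq : Valued.v z₂⁻¹ * Valued.v z₂⁻¹ = (Valued.v y)⁻¹ := by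
    have hmul : Valued.v z₂ * Valued.v z₂ = Valued.v (z₂ * σ z₂) := by rw [map_mul, hvσ]
    rw [map_inv₀, ← mul_inv, hmul, hz₂, map_mul, hξ1, one_mul]
  rw [hsq, le_inv_comm₀ exp_pos ((Valuation.pos_iff _).2 hy0), ← exp_neg]
  exact hyle

/-- **SHARPNESS, MATRIX FORM**: at a wild ramified datum some `g ∈ SU(⟨1,−ξ⟩)(F)` (`(σg)ᵀ·diag(1,−ξ)·g = diag(1,−ξ)`, `det g = 1`) has `|g₁₀| = exp(d−1)` — together with
`valued_entry_le_exp_of_unitary_anisoPlane` the level of `U(⟨1,−ξ⟩)` is exactly `d − 1`. [cite: Rogawski1990, §3.8 p. 33] [cite: Jacobowitz1962, §§9–11] -/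
theorem exists_unitary_anisoPlane_valued_entry_eq_exp [CompleteSpace K] [Finite 𝓀[K]] (hD : IsRamifiedQuadraticDatum σ ϖ d t) (h2v : Valued.v (2 : K) < 1)
    {ξ : K} (hσξ : σ ξ = ξ) (hξ1 : Valued.v ξ = 1) (hξN : ¬ ∃ z : K, z * σ z = ξ) :
    ∃ g : Matrix (Fin 2) (Fin 2) K, (g.map σ)ᵀ * !![(1 : K), 0; 0, -ξ] * g = !![(1 : K), 0; 0, -ξ] ∧ g.det = 1 ∧ Valued.v (g 1 0) = exp ((d - 1 : ℕ) : ℤ) := by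
  have hσ := hD.1
  obtain ⟨α, β, h, hβ⟩ := exists_norm_sub_mul_norm_eq_one_valued_eq_exp hD h2v hσξ hξ1 hξN
  refine ⟨!![α, ξ * σ β; β, σ α], ?_, ?_, by simpa using hβ⟩
  · ext i j
    fin_cases i <;> fin_cases j <;>
      simp only [Matrix.mul_apply, Fin.sum_univ_two, Matrix.transpose_apply, Matrix.map_apply, Matrix.of_apply, Matrix.cons_val', Matrix.cons_val_zero,
        Matrix.cons_val_one, Matrix.empty_val', Matrix.cons_val_fin_one, map_mul, hσ, hσξ, Fin.zero_eta, Fin.mk_one, Fin.isValue] <;>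
      first | ring1 | linear_combination h | linear_combination (-ξ) * h
  · rw [Matrix.det_fin_two_of]
    linear_combination h

end Datum

/-! ## §3 CM dress at a ramified place `w ∣ v` of `L ∕ L⁺`, in the `(hd)`-binder currency of the (L) kit -/

section CM

variable (L : Type) [Field L] [NumberField L] [IsCMField L] (v : HeightOneSpectrum (𝓞 ↥(maximalRealSubfield L)))
  (w : PlacesOver L v) (hw : IsCMField.complexConj L • w.1 = w.1)

include hw in
/-- The datum at a ramified CM place with PRESCRIBED different exponent `d` (the (L)-kit binder `hd : ∀ τ, |τ| = exp(−1) → |σ_wτ − τ| = exp(−d)`): some `t` with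
`IsRamifiedQuadraticDatum σ_w ϖ d t` for any uniformiser `ϖ` (★ `exists_isRamifiedQuadraticDatum_of_placesOver` + the `hd` reading of its clause 5). [cite: Serre1979, Ch. IV §1–2] -/
theorem exists_isRamifiedQuadraticDatum_of_hd (he : v.asIdeal.ramificationIdx' w.1.asIdeal ≠ 1) {d : ℕ}
    (hd : ∀ τ : w.1.adicCompletion L, Valued.v τ = exp (-1 : ℤ) →
      Valued.v (galAdicCompletionMap (L := L) (IsCMField.complexConj L) hw τ - τ) = exp (-(d : ℤ)))
    {ϖ : w.1.adicCompletion L} (hϖ : Valued.v ϖ = exp (-1 : ℤ)) :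
    ∃ t : ℕ, IsRamifiedQuadraticDatum (galAdicCompletionMap (L := L) (IsCMField.complexConj L) hw) ϖ d t := by
  obtain ⟨d', t, hD⟩ := exists_isRamifiedQuadraticDatum_of_placesOver L w hw he ϖ hϖ
  have hdd : d' = d := by
    have h5 : Valued.v (galAdicCompletionMap (L := L) (IsCMField.complexConj L) hw ϖ - ϖ) = Valued.v ϖ ^ d' := by
      rw [← neg_sub, Valuation.map_neg]; exact hD.2.2.2.2.1
    rw [hd ϖ hϖ, hϖ, ← exp_nsmul, exp_inj, nsmul_eq_mul, mul_neg, mul_one, neg_inj] at h5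
    exact_mod_cast h5.symm
  subst hdd
  exact ⟨t, hD⟩

include hw in
/-- **THE LEVEL OF `U(⟨1,−ξ⟩)(L⁺_v)` AT A RAMIFIED PLACE (CM dress)**: `w ∣ v` non-split ramified with different exponent `d` (`hd`), `ξ ∈ L` fixed by `c` with `ξ_w` a non-norm unit
(the W1 package ★ p856881); every `g ∈ M₂(L_w)` with `(σ_w g)ᵀ·diag(1,−ξ_w)·g = diag(1,−ξ_w)` has all entries of valuation `≤ exp(d−1)`.  Tame (`d = 1`): integral (★ (r)).
[cite: Serre1979, Ch. V §3 Cor. 3] [cite: Rogawski1990, §3.8 p. 33] [cite: VignerasLNM800, Ch. II §1] -/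
theorem valued_entry_le_exp_of_unitary_anisoPlane_place (he : v.asIdeal.ramificationIdx' w.1.asIdeal ≠ 1) {d : ℕ}
    (hd : ∀ τ : w.1.adicCompletion L, Valued.v τ = exp (-1 : ℤ) →
      Valued.v (galAdicCompletionMap (L := L) (IsCMField.complexConj L) hw τ - τ) = exp (-(d : ℤ)))
    {ξ : L} (hξc : IsCMField.complexConj L ξ = ξ) (hξ1 : Valued.v (algebraMap L (w.1.adicCompletion L) ξ) = 1)
    (hξN : ¬ ∃ t : w.1.adicCompletion L, t * galAdicCompletionMap (L := L) (IsCMField.complexConj L) hw t = algebraMap L (w.1.adicCompletion L) ξ)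
    {g : Matrix (Fin 2) (Fin 2) (w.1.adicCompletion L)}
    (hg : (g.map (galAdicCompletionMap (L := L) (IsCMField.complexConj L) hw))ᵀ * !![(1 : w.1.adicCompletion L), 0; 0, -algebraMap L (w.1.adicCompletion L) ξ] * g =
      !![(1 : w.1.adicCompletion L), 0; 0, -algebraMap L (w.1.adicCompletion L) ξ]) (i j : Fin 2) :
    Valued.v (g i j) ≤ exp ((d - 1 : ℕ) : ℤ) := by
  obtain ⟨ϖ, hϖ⟩ := exists_valued_eq_exp_neg_one L v w
  obtain ⟨t, hD⟩ := exists_isRamifiedQuadraticDatum_of_hd L v w hw he hd hϖ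
  exact valued_entry_le_exp_of_unitary_anisoPlane hD (galAdicCompletionMap_algebraMap_of_complexConj_eq L v w hw hξc) hξ1 hξN hg i j

include hw in
/-- **SHARPNESS AT A WILD PLACE (CM dress)**: `w ∣ v` non-split, ramified with different exponent `d` (`hd`), DYADIC (`2 ∈ v`); for the W1 unit `ξ` some `g ∈ SU(⟨1,−ξ_w⟩)(L_w)` has
`|g₁₀|_w = exp(d−1)` — the level `d − 1 ≥ 1` of `valued_entry_le_exp_of_unitary_anisoPlane_place` is attained, so `[U_an : K_an] > 1` and (W3) must count it.
[cite: Serre1979, Ch. V §3 Cor. 3; Ch. XV §2] [cite: Jacobowitz1962, §§9–11] [cite: Kottwitz1988, §1 Thm. 1] -/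
theorem exists_unitary_anisoPlane_valued_entry_eq_exp_place (he : v.asIdeal.ramificationIdx' w.1.asIdeal ≠ 1) (h2 : (2 : 𝓞 ↥(maximalRealSubfield L)) ∈ v.asIdeal) {d : ℕ}
    (hd : ∀ τ : w.1.adicCompletion L, Valued.v τ = exp (-1 : ℤ) →
      Valued.v (galAdicCompletionMap (L := L) (IsCMField.complexConj L) hw τ - τ) = exp (-(d : ℤ)))
    {ξ : L} (hξc : IsCMField.complexConj L ξ = ξ) (hξ1 : Valued.v (algebraMap L (w.1.adicCompletion L) ξ) = 1)
    (hξN : ¬ ∃ t : w.1.adicCompletion L, t * galAdicCompletionMap (L := L) (IsCMField.complexConj L) hw t = algebraMap L (w.1.adicCompletion L) ξ) :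
    ∃ g : Matrix (Fin 2) (Fin 2) (w.1.adicCompletion L),
      (g.map (galAdicCompletionMap (L := L) (IsCMField.complexConj L) hw))ᵀ * !![(1 : w.1.adicCompletion L), 0; 0, -algebraMap L (w.1.adicCompletion L) ξ] * g =
          !![(1 : w.1.adicCompletion L), 0; 0, -algebraMap L (w.1.adicCompletion L) ξ] ∧
        g.det = 1 ∧ Valued.v (g 1 0) = exp ((d - 1 : ℕ) : ℤ) := by
  haveI : Finite 𝓀[w.1.adicCompletion L] := finite_residueField_adicCompletion L w.1
  obtain ⟨ϖ, hϖ⟩ := exists_valued_eq_exp_neg_one L v w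
  obtain ⟨t, hD⟩ := exists_isRamifiedQuadraticDatum_of_hd L v w hw he hd hϖ
  exact exists_unitary_anisoPlane_valued_entry_eq_exp hD (valued_two_lt_one_of_two_mem L v w h2) (galAdicCompletionMap_algebraMap_of_complexConj_eq L v w hw hξc)
    hξ1 hξN

end CM

end Summit.HodgeConjecture.HodgeConjecture.Cruxes.H413.K2E3WildAnisotropicPlaneIndex

end
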